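import Summits.ABC.IUTFork.DAGL1c
import Summits.ABC.IUTFork.DAGL1d
import Summits.ABC.IUTFork.DAGL1e
import Summits.ABC.IUTFork.DAGL1f
import Summits.ABC.IUTFork.DAGL1s
import Summits.ABC.IUTFork.DAGL1t
import Summits.ABC.IUTFork.DAGL1u
import Summits.ABC.IUTFork.DAGL1v
import Summits.ABC.IUTFork.DAGL1x
import Summits.ABC.IUTFork.DAGL1y
import Summits.ABC.IUTFork.DAGL1z
import Summits.ABC.IUTFork.DAGL1za
import Summits.ABC.IUTFork.DAGUa
import Summits.ABC.IUTFork.DAGUb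
import Summits.ABC.IUTFork.DAGUc
import HarnessLib

/-!
# L1 LAYER CERTIFICATE, part B — the [FrdI] §4–§6 and [FrdII] members of the Cor 3.12 cone, packaged BY NAME over the kernel DAG index

abc-iut cell, director-abc (C2) «Conditional/Layer<k>OfS»; abc-iut-L1-lead R121 (5) «CERT-L1» (holder abc-iut-L1-d4 gen 5), companion of
`Conditional/Layer1OfSa.lean` (part A, [FrdI] §1–§3) in the grammar of `Conditional/Layer6OfSa.lean`. NODE LIST OF RECORD = plan/CONE-BOARD.tsv ⋈
plan/COR312-CONE.tsv (L1 cone = 176 nodes; this part = the 92 members outside [FrdI] §1–§3: [FrdI] §4–§6 = 43, [FrdII] = 49); STATUS SOURCE =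
plan/L1/NODES.md (overlay #43, 2026-08-26T06:40Z; NODES wins over CONE-BOARD); KERNEL INDEX = abc-iut-c312-2's `Summits/ABC/IUTFork/DAGL1*.lean`
+ witness-upgrade parts `DAGUa/DAGUb` + sub-DAG rows (DAGL1x/y); FILE-OF-RECORD keying = plan/L1/CONE-FREEZE-L1.tsv (R121 (6)).

THIS FILE PROVES NOTHING NEW AND ASSERTS NOTHING: every conjunct is an index Prop `N_<id>` / index sub-row Prop BY NAME (universe-instantiated
with the index's level names) and every witness is the index's own `_holds` / `_part` term BY NAME — no tactic proof of content, no restatement,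
no new `def … : Prop` fact, no `instance`, no schema ∀-closed.

COUNT LINE («nodes = d + r + d_data + refuted-as-typed»): **92 = d 45 (NODES-DISCHARGED claim nodes, tags DISCHARGED-(H), DISCHARGED-partial,
DISCHARGED-conditional, DISCHARGED-bound kept per line) + r 9 (Residual: claim-form index Props of nodes NODES does not mark discharged —
the [FrdII] Definitions 2.1 (i)(ii), 2.2 (i)(ii), 3.1 (i)–(v), typed ACCEPTED) + d_data 37 (data-form index aliases of definitions / structures /
Prop-valued SCHEMAS over binders — LISTED and name-checked below, never conjoined, never ∀-closed) + refuted-as-typed 1 ([FrdI] Prop 4.4 (iii):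
NODES = REFUTED-as-typed — the typed universal reading was refuted at a model (p411683) and the repaired form proved (p412124); its index Prop
(a conjunction of landed theorems) is LISTED, not conjoined, K3).** 45 + 9 + 37 + 1 = 92. Discharge SUB-ROWS with `_holds`
(sub-DAG rows of Cor 4.11 (i)(ii)(iii), Thm 4.2 (i)(ii)(iii), Prop 5.3, Thm 6.2 (i), Thm 6.4 (i), [FrdII] Thm 1.2 (i)(v), Thm 2.4 (i)(ii)) enter
`Layer1DischargedB` next to their node (K4-exception of the L6 grammar), also when the node itself is data-form.
KERNEL NOTE (honest): every index claim Prop is a `StatementOf` conjunction of LANDED theorems, so each RESIDUAL conjunct is kernel-inhabited by the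
index's `_part`/`_holds`; «discharged vs residual» is the NODES row STATUS (the layer lead's judgement that the typed theorems cover the printed
item), not kernel provability; no residual conjunct is an open kernel obligation. S (`PilotKummerIndRelated`) is NOT consumed at L1; FACT-LIST rows
enter only as hypotheses INSIDE the conjoined statements (instance forms), never as free hypotheses of this file.
HONEST FRAMING: typed ≠ proved; indexed ≠ endorsed; witnessed ≠ lead-discharged; nothing here asserts that abc is proved or refuted or takes a
side on [IUTchIII] Cor. 3.12. [claim: Mochizuki2012, status: disputed] (node texts: [FrdI]/[FrdII] = Mochizuki, Kyushu J. Math. 62 (2008)).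

d_data — LISTED (index alias; NODES status; index part):
* FrdI:Cor4.11(i) — `N_FrdI_Cor4_11_i` (DAGL1s); NODES=DISCHARGED-conditional
* FrdI:Cor4.11(ii) — `N_FrdI_Cor4_11_ii` (DAGL1s); NODES=ACCEPTED
* FrdI:Cor4.11(iii) — `N_FrdI_Cor4_11_iii` (DAGL1s); NODES=ACCEPTED
* FrdI:Cor4.11(iv) — `N_FrdI_Cor4_11_iv` (DAGL1s); NODES=DISCHARGED-conditional
* FrdI:Cor5.4 — `N_FrdI_Cor5_4` (DAGL1t); NODES=DISCHARGED-partial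
* FrdI:Prop5.5(i) — `N_FrdI_Prop5_5_i` (DAGL1t); NODES=DISCHARGED
* FrdI:Prop5.5(ii) — `N_FrdI_Prop5_5_ii` (DAGL1t); NODES=DISCHARGED-partial
* FrdI:Prop5.5(iii) — `N_FrdI_Prop5_5_iii` (DAGL1t); NODES=DISCHARGED-partial
* FrdI:Prop5.5(iv) — `N_FrdI_Prop5_5_iv` (DAGL1t); NODES=DISCHARGED
* FrdI:Prop5.6 — `N_FrdI_Prop5_6` (DAGL1t); NODES=DISCHARGED
* FrdI:Thm4.2(i) — `N_FrdI_Thm4_2_i` (DAGL1s); NODES=DISCHARGED-partial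
* FrdI:Thm4.2(ii) — `N_FrdI_Thm4_2_ii` (DAGL1s); NODES=DISCHARGED-partial
* FrdI:Thm4.2(iii) — `N_FrdI_Thm4_2_iii` (DAGL1s); NODES=DISCHARGED-partial
* FrdI:Thm4.9 — `N_FrdI_Thm4_9` (DAGL1s); NODES=DISCHARGED
* FrdI:Thm5.1(ii) — `N_FrdI_Thm5_1_ii` (DAGL1s); NODES=DISCHARGED
* FrdI:Thm5.1(iv) — `N_FrdI_Thm5_1_iv` (DAGL1s); NODES=DISCHARGED
* FrdI:Thm5.2(iii) — `N_FrdI_Thm5_2_iii` (DAGL1d); NODES=DISCHARGED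
* FrdI:Thm6.2(iv) — `N_FrdI_Thm6_2_iv` (DAGL1t); NODES=DISCHARGED
* FrdI:Thm6.4(i) — `N_FrdI_Thm6_4_i` (DAGL1t); NODES=DISCHARGED-partial
* FrdI:Thm6.4(ii) — `N_FrdI_Thm6_4_ii` (DAGL1t); NODES=DISCHARGED-partial
* FrdI:Thm6.4(iii) — `N_FrdI_Thm6_4_iii` (DAGL1t); NODES=DISCHARGED-partial
* FrdII:Def2.2(iii) — `N_FrdII_Def2_2_iii` (DAGL1u); NODES=ACCEPTED
* FrdII:Ex1.1(ii) — `N_FrdII_Ex1_1_ii` (DAGL1t); NODES=DISCHARGED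
* FrdII:Ex1.3(iii) — `N_FrdII_Ex1_3_iii` (DAGL1e); NODES=DISCHARGED
* FrdII:Lem3.2(vii) — `N_FrdII_Lem3_2_vii` (DAGL1u); NODES=DISCHARGED
* FrdII:Thm2.4(i) — `N_FrdII_Thm2_4_i` (DAGL1u); NODES=DISCHARGED-conditional
* FrdII:Thm2.4(ii) — `N_FrdII_Thm2_4_ii` (DAGL1u); NODES=DISCHARGED-conditional
* FrdII:Thm3.6(i) — `N_FrdII_Thm3_6_i` (DAGL1v); NODES=DISCHARGED-partial
* FrdII:Thm3.6(ii) — `N_FrdII_Thm3_6_ii` (DAGL1v); NODES=DISCHARGED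
* FrdII:Thm3.6(iii) — `N_FrdII_Thm3_6_iii` (DAGL1v); NODES=DISCHARGED
* FrdII:Thm3.6(iv) — `N_FrdII_Thm3_6_iv` (DAGL1v); NODES=DISCHARGED-partial
* FrdII:Thm3.6(ix) — `N_FrdII_Thm3_6_ix` (DAGL1v); NODES=DISCHARGED
* FrdII:Thm3.6(v) — `N_FrdII_Thm3_6_v` (DAGL1v); NODES=DISCHARGED-partial
* FrdII:Thm3.6(vi) — `N_FrdII_Thm3_6_vi` (DAGL1v); NODES=DISCHARGED-partial
* FrdII:Thm3.6(vii) — `N_FrdII_Thm3_6_vii` (DAGL1v); NODES=DISCHARGED-partial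
* FrdII:Thm3.6(viii) — `N_FrdII_Thm3_6_viii` (DAGL1v); NODES=DISCHARGED
* FrdII:Thm3.6(x) — `N_FrdII_Thm3_6_x` (DAGL1v); NODES=DISCHARGED-partial
refuted-as-typed — LISTED: * FrdI:Prop4.4(iii) — `N_FrdI_Prop4_4_iii` (DAGL1s); NODES=REFUTED-as-typed
-/

namespace Summit.ABC.IUTFork.Conditional

open Summit.ABC.IUTFork.DAG

noncomputable section

universe u₁ u₂ u₃ u₄ u₅ u₆ u₇ u₈ u₉ u₁₀ u₁₁ u₁₂ u₁₃ u₁₄ u₁₅ u₁₆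

/-- **L1 discharged, part B** ([FrdI] §4–§6, [FrdII]): the index Props of the NODES-DISCHARGED cone nodes (+ discharge sub-rows), BY NAME.
[claim: Mochizuki2012, status: disputed] -/
def Layer1DischargedB : Prop :=
  N_FrdI_Cor4_10.{u₁, u₂, u₃, u₄, u₅, u₆, u₇, u₈, u₉, u₁₀} -- FrdI:Cor4.10 · NODES=DISCHARGED · DAGL1s · `_holds`
  ∧ N_FrdI_Ex4_3 -- FrdI:Ex4.3 · NODES=DISCHARGED · DAGL1s · `_holds`
  ∧ N_FrdI_Ex6_3.{u₁} -- FrdI:Ex6.3 · NODES=DISCHARGED · DAGL1e · `_holds` (DAGUa)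
  ∧ N_FrdI_Prop4_1_i.{u₁, u₂, u₃, u₄, u₅} -- FrdI:Prop4.1(i) · NODES=DISCHARGED · DAGL1z · `_holds`
  ∧ N_FrdI_Prop4_1_ii.{u₁} -- FrdI:Prop4.1(ii) · NODES=DISCHARGED · DAGL1s · `_holds`
  ∧ N_FrdI_Prop4_1_iii.{u₁, u₂, u₃, u₄, u₅} -- FrdI:Prop4.1(iii) · NODES=DISCHARGED · DAGL1z · `_holds`
  ∧ N_FrdI_Prop4_1_iv.{u₁, u₂, u₃, u₄, u₅} -- FrdI:Prop4.1(iv) · NODES=DISCHARGED · DAGL1z · `_holds`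
  ∧ N_FrdI_Prop4_1_v.{u₁, u₂, u₃, u₄, u₅} -- FrdI:Prop4.1(v) · NODES=DISCHARGED · DAGL1z · `_holds`
  ∧ N_FrdI_Prop4_4_i.{u₁} -- FrdI:Prop4.4(i) · NODES=DISCHARGED · DAGL1d · `_holds` (DAGUa)
  ∧ N_FrdI_Prop4_4_ii.{u₁, u₂, u₃, u₄, u₅} -- FrdI:Prop4.4(ii) · NODES=DISCHARGED · DAGL1s · `_holds`
  ∧ N_FrdI_Prop4_4_iv.{u₁} -- FrdI:Prop4.4(iv) · NODES=DISCHARGED · DAGL1d · `_holds` (DAGUa)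
  ∧ N_FrdI_Prop5_3.{u₁, u₂, u₃} -- FrdI:Prop5.3 · NODES=DISCHARGED · DAGL1t · `_holds` (DAGUa)
  ∧ N_FrdI_Prop5_3_L02a.{u₁, u₂, u₃} -- sub-row of FrdI:Prop5.3 · DAGL1za · `_holds`
  ∧ N_FrdI_Thm5_1_i.{u₁, u₂, u₃, u₄, u₅} -- FrdI:Thm5.1(i) · NODES=DISCHARGED · DAGL1s · `_holds`
  ∧ N_FrdI_Thm5_1_iii.{u₁, u₂, u₃, u₄, u₅} -- FrdI:Thm5.1(iii) · NODES=DISCHARGED · DAGL1s · `_holds`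
  ∧ N_FrdI_Thm5_2_i.{u₁, u₂, u₃} -- FrdI:Thm5.2(i) · NODES=DISCHARGED · DAGL1d · `_holds` (DAGUb)
  ∧ N_FrdI_Thm5_2_ii.{u₁, u₂, u₃} -- FrdI:Thm5.2(ii) · NODES=DISCHARGED · DAGL1s · `_holds`
  ∧ N_FrdI_Thm5_2_iv.{u₁, u₂, u₃, u₄, u₅} -- FrdI:Thm5.2(iv) · NODES=DISCHARGED · DAGL1t · `_holds`
  ∧ N_FrdI_Thm6_2_i -- FrdI:Thm6.2(i) · NODES=DISCHARGED · DAGL1t · `_holds`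
  ∧ N_FrdI_Thm6_2_i_L03 -- sub-row of FrdI:Thm6.2(i) · DAGL1y · `_holds`
  ∧ N_FrdI_Thm6_2_i_L05 -- sub-row of FrdI:Thm6.2(i) · DAGL1y · `_holds`
  ∧ N_FrdI_Thm6_2_ii -- FrdI:Thm6.2(ii) · NODES=DISCHARGED · DAGL1t · `_holds` (DAGUa)
  ∧ N_FrdI_Thm6_2_iii -- FrdI:Thm6.2(iii) · NODES=DISCHARGED-partial · DAGL1t · `_holds`
  ∧ N_FrdI_Thm6_4_iv -- FrdI:Thm6.4(iv) · NODES=DISCHARGED-partial · DAGL1t · `_holds`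
  ∧ N_FrdII_Ex1_1_i.{u₁} -- FrdII:Ex1.1(i) · NODES=DISCHARGED · DAGL1t · `_holds` (DAGUc)
  ∧ N_FrdII_Ex1_3_i.{u₁, u₂} -- FrdII:Ex1.3(i) · NODES=DISCHARGED · DAGL1e · `_holds` (DAGUc)
  ∧ N_FrdII_Ex1_3_ii.{u₁} -- FrdII:Ex1.3(ii) · NODES=DISCHARGED · DAGL1e · `_holds` (DAGUc)
  ∧ N_FrdII_Ex3_3_i -- FrdII:Ex3.3(i) · NODES=DISCHARGED · DAGL1v · `_holds` (DAGUa)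
  ∧ N_FrdII_Ex3_3_ii.{u₁, u₂} -- FrdII:Ex3.3(ii) · NODES=DISCHARGED · DAGL1v · `_holds`
  ∧ N_FrdII_Ex3_3_iii.{u₁, u₂, u₃, u₄, u₅} -- FrdII:Ex3.3(iii) · NODES=DISCHARGED · DAGL1v · `_holds` (DAGUa)
  ∧ N_FrdII_Ex3_3_iv -- FrdII:Ex3.3(iv) · NODES=DISCHARGED · DAGL1v · `_holds` (DAGUa)
  ∧ N_FrdII_Ex3_3_v -- FrdII:Ex3.3(v) · NODES=DISCHARGED · DAGL1v · `_holds` (DAGUa)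
  ∧ N_FrdII_Lem3_2_i -- FrdII:Lem3.2(i) · NODES=DISCHARGED · DAGL1u · `_holds`
  ∧ N_FrdII_Lem3_2_ii -- FrdII:Lem3.2(ii) · NODES=DISCHARGED · DAGL1u · `_holds`
  ∧ N_FrdII_Lem3_2_iii -- FrdII:Lem3.2(iii) · NODES=DISCHARGED · DAGL1u · `_holds`
  ∧ N_FrdII_Lem3_2_iv -- FrdII:Lem3.2(iv) · NODES=DISCHARGED · DAGL1u · `_holds`
  ∧ N_FrdII_Lem3_2_ix -- FrdII:Lem3.2(ix) · NODES=DISCHARGED · DAGL1v · `_holds`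
  ∧ N_FrdII_Lem3_2_v -- FrdII:Lem3.2(v) · NODES=DISCHARGED · DAGL1u · `_holds`
  ∧ N_FrdII_Lem3_2_vi -- FrdII:Lem3.2(vi) · NODES=DISCHARGED · DAGL1u · `_holds`
  ∧ N_FrdII_Lem3_2_viii -- FrdII:Lem3.2(viii) · NODES=DISCHARGED · DAGL1u · `_holds`
  ∧ N_FrdII_Lem3_2_x -- FrdII:Lem3.2(x) · NODES=DISCHARGED · DAGL1v · `_holds`
  ∧ N_FrdII_Lem3_2_xi -- FrdII:Lem3.2(xi) · NODES=DISCHARGED · DAGL1v · `_holds`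
  ∧ N_FrdII_Lem3_2_xii -- FrdII:Lem3.2(xii) · NODES=DISCHARGED · DAGL1v · `_holds`
  ∧ N_FrdII_Thm1_2_i.{u₁, u₂, u₃} -- FrdII:Thm1.2(i) · NODES=DISCHARGED · DAGL1t · `_holds`
  ∧ N_FrdII_Thm1_2_i_L01.{u₁, u₂} -- sub-row of FrdII:Thm1.2(i) · DAGL1y · `_holds`
  ∧ N_FrdII_Thm1_2_i_L02.{u₁, u₂} -- sub-row of FrdII:Thm1.2(i) · DAGL1y · `_holds`
  ∧ N_FrdII_Thm1_2_i_L03.{u₁, u₂} -- sub-row of FrdII:Thm1.2(i) · DAGL1y · `_holds`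
  ∧ N_FrdII_Thm1_2_i_L04.{u₁, u₂} -- sub-row of FrdII:Thm1.2(i) · DAGL1y · `_holds`
  ∧ N_FrdII_Thm1_2_i_L05.{u₁, u₂} -- sub-row of FrdII:Thm1.2(i) · DAGL1y · `_holds`
  ∧ N_FrdII_Thm1_2_i_L06.{u₁, u₂} -- sub-row of FrdII:Thm1.2(i) · DAGL1y · `_holds`
  ∧ N_FrdII_Thm1_2_i_L07.{u₁, u₂} -- sub-row of FrdII:Thm1.2(i) · DAGL1y · `_holds`
  ∧ N_FrdII_Thm1_2_i_L08.{u₁, u₂, u₃, u₄, u₅} -- sub-row of FrdII:Thm1.2(i) · DAGL1y · `_holds`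
  ∧ N_FrdII_Thm1_2_ii.{u₁, u₂, u₃} -- FrdII:Thm1.2(ii) · NODES=DISCHARGED · DAGL1t · `_holds`
  ∧ N_FrdII_Thm1_2_iii.{u₁, u₂, u₃} -- FrdII:Thm1.2(iii) · NODES=DISCHARGED · DAGL1t · `_holds`
  ∧ N_FrdII_Thm1_2_iv.{u₁, u₂} -- FrdII:Thm1.2(iv) · NODES=DISCHARGED · DAGL1t · `_holds`
  ∧ N_FrdII_Thm1_2_v.{u₁, u₂, u₃} -- FrdII:Thm1.2(v) · NODES=DISCHARGED · DAGL1t · `_holds`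
  ∧ N_FrdII_Thm1_2_v_L01.{u₁, u₂} -- sub-row of FrdII:Thm1.2(v) · DAGL1y · `_holds`
  ∧ N_FrdI_Cor4_11_i_L01.{u₁, u₂, u₃, u₄, u₅} -- sub-row of FrdI:Cor4.11(i) (node itself data-form/listed) · DAGL1x · `_holds`
  ∧ N_FrdI_Cor4_11_i_L04.{u₁, u₂, u₃, u₄, u₅, u₆, u₇, u₈, u₉, u₁₀} -- sub-row of FrdI:Cor4.11(i) (node itself data-form/listed) · DAGL1x · `_holds`
  ∧ N_FrdI_Cor4_11_i_L05.{u₁, u₂, u₃, u₄, u₅} -- sub-row of FrdI:Cor4.11(i) (node itself data-form/listed) · DAGL1x · `_holds`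
  ∧ N_FrdI_Cor4_11_i_L06.{u₁, u₂, u₃, u₄, u₅} -- sub-row of FrdI:Cor4.11(i) (node itself data-form/listed) · DAGL1x · `_holds`
  ∧ N_FrdI_Cor4_11_i_L07.{u₁, u₂, u₃, u₄, u₅} -- sub-row of FrdI:Cor4.11(i) (node itself data-form/listed) · DAGL1x · `_holds`
  ∧ N_FrdI_Cor4_11_ii_L08.{u₁, u₂, u₃, u₄, u₅, u₆, u₇, u₈, u₉, u₁₀} -- sub-row of FrdI:Cor4.11(ii) (node itself data-form/listed) · DAGL1x · `_holds`
  ∧ N_FrdI_Cor4_11_ii_L14.{u₁, u₂, u₃, u₄, u₅, u₆, u₇, u₈, u₉, u₁₀, u₁₁, u₁₂, u₁₃, u₁₄, u₁₅, u₁₆} -- sub-row of FrdI:Cor4.11(ii) (node itself data-form/listed) · DAGL1x · `_holds`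
  ∧ N_FrdI_Cor4_11_ii_L15.{u₁, u₂, u₃, u₄, u₅, u₆, u₇, u₈, u₉, u₁₀} -- sub-row of FrdI:Cor4.11(ii) (node itself data-form/listed) · DAGL1x · `_holds`
  ∧ N_FrdI_Cor4_11_ii_L17.{u₁, u₂, u₃, u₄, u₅} -- sub-row of FrdI:Cor4.11(ii) (node itself data-form/listed) · DAGL1x · `_holds`
  ∧ N_FrdI_Cor4_11_iii_L19.{u₁, u₂, u₃, u₄, u₅, u₆, u₇, u₈, u₉, u₁₀} -- sub-row of FrdI:Cor4.11(iii) (node itself data-form/listed) · DAGL1x · `_holds`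
  ∧ N_FrdI_Cor4_11_iii_L20.{u₁, u₂, u₃, u₄, u₅, u₆, u₇, u₈, u₉, u₁₀, u₁₁, u₁₂} -- sub-row of FrdI:Cor4.11(iii) (node itself data-form/listed) · DAGL1x · `_holds`
  ∧ N_FrdI_Thm4_2_i_T42_L02.{u₁, u₂, u₃, u₄, u₅, u₆, u₇, u₈, u₉, u₁₀} -- sub-row of FrdI:Thm4.2(i) (node itself data-form/listed) · DAGL1x · `_holds`
  ∧ N_FrdI_Thm4_2_i_T42_L04.{u₁, u₂, u₃, u₄, u₅, u₆, u₇, u₈, u₉, u₁₀} -- sub-row of FrdI:Thm4.2(i) (node itself data-form/listed) · DAGL1x · `_holds`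
  ∧ N_FrdI_Thm4_2_ii_T42_L08.{u₁, u₂, u₃, u₄, u₅, u₆, u₇, u₈, u₉, u₁₀} -- sub-row of FrdI:Thm4.2(ii) (node itself data-form/listed) · DAGL1x · `_holds`
  ∧ N_FrdI_Thm4_2_iii_T42_L12.{u₁, u₂, u₃, u₄, u₅, u₆, u₇, u₈, u₉, u₁₀} -- sub-row of FrdI:Thm4.2(iii) (node itself data-form/listed) · DAGL1x · `_holds`
  ∧ N_FrdI_Thm4_2_iii_T42_L13.{u₁, u₂} -- sub-row of FrdI:Thm4.2(iii) (node itself data-form/listed) · DAGL1y · `_holds`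
  ∧ N_FrdI_Thm6_4_i_L11.{u₁, u₂, u₃, u₄, u₅} -- sub-row of FrdI:Thm6.4(i) (node itself data-form/listed) · DAGL1y · `_holds`
  ∧ N_FrdII_Thm2_4_i_L04 -- sub-row of FrdII:Thm2.4(i) (node itself data-form/listed) · DAGL1y · `_holds`
  ∧ N_FrdII_Thm2_4_i_L05 -- sub-row of FrdII:Thm2.4(i) (node itself data-form/listed) · DAGL1y · `_holds`
  ∧ N_FrdII_Thm2_4_i_L07 -- sub-row of FrdII:Thm2.4(i) (node itself data-form/listed) · DAGL1y · `_holds`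
  ∧ N_FrdII_Thm2_4_i_L08 -- sub-row of FrdII:Thm2.4(i) (node itself data-form/listed) · DAGL1y · `_holds`
  ∧ N_FrdII_Thm2_4_i_L09.{u₁, u₂} -- sub-row of FrdII:Thm2.4(i) (node itself data-form/listed) · DAGL1y · `_holds`
  ∧ N_FrdII_Thm2_4_i_L11 -- sub-row of FrdII:Thm2.4(i) (node itself data-form/listed) · DAGL1y · `_holds`
  ∧ N_FrdII_Thm2_4_i_L12 -- sub-row of FrdII:Thm2.4(i) (node itself data-form/listed) · DAGL1y · `_holds`
  ∧ N_FrdII_Thm2_4_ii_L24 -- sub-row of FrdII:Thm2.4(ii) (node itself data-form/listed) · DAGL1y · `_holds`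

/-- `Layer1DischargedB` holds: the index witnesses BY NAME (nothing new). [claim: Mochizuki2012, status: disputed] -/
theorem layer1DischargedB_holds : Layer1DischargedB.{u₁, u₂, u₃, u₄, u₅, u₆, u₇, u₈, u₉, u₁₀, u₁₁, u₁₂, u₁₃, u₁₄, u₁₅, u₁₆} :=
  ⟨N_FrdI_Cor4_10_holds,
    N_FrdI_Ex4_3_holds,
    N_FrdI_Ex6_3_holds,
    N_FrdI_Prop4_1_i_holds,
    N_FrdI_Prop4_1_ii_holds,
    N_FrdI_Prop4_1_iii_holds,
    N_FrdI_Prop4_1_iv_holds,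
    N_FrdI_Prop4_1_v_holds,
    N_FrdI_Prop4_4_i_holds,
    N_FrdI_Prop4_4_ii_holds,
    N_FrdI_Prop4_4_iv_holds,
    N_FrdI_Prop5_3_holds,
    N_FrdI_Prop5_3_L02a_holds,
    N_FrdI_Thm5_1_i_holds,
    N_FrdI_Thm5_1_iii_holds,
    N_FrdI_Thm5_2_i_holds,
    N_FrdI_Thm5_2_ii_holds,
    N_FrdI_Thm5_2_iv_holds,
    N_FrdI_Thm6_2_i_holds,
    N_FrdI_Thm6_2_i_L03_holds,
    N_FrdI_Thm6_2_i_L05_holds,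
    N_FrdI_Thm6_2_ii_holds,
    N_FrdI_Thm6_2_iii_holds,
    N_FrdI_Thm6_4_iv_holds,
    N_FrdII_Ex1_1_i_holds,
    N_FrdII_Ex1_3_i_holds,
    N_FrdII_Ex1_3_ii_holds,
    N_FrdII_Ex3_3_i_holds,
    N_FrdII_Ex3_3_ii_holds,
    N_FrdII_Ex3_3_iii_holds,
    N_FrdII_Ex3_3_iv_holds,
    N_FrdII_Ex3_3_v_holds,
    N_FrdII_Lem3_2_i_holds,
    N_FrdII_Lem3_2_ii_holds,
    N_FrdII_Lem3_2_iii_holds,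
    N_FrdII_Lem3_2_iv_holds,
    N_FrdII_Lem3_2_ix_holds,
    N_FrdII_Lem3_2_v_holds,
    N_FrdII_Lem3_2_vi_holds,
    N_FrdII_Lem3_2_viii_holds,
    N_FrdII_Lem3_2_x_holds,
    N_FrdII_Lem3_2_xi_holds,
    N_FrdII_Lem3_2_xii_holds,
    N_FrdII_Thm1_2_i_holds,
    N_FrdII_Thm1_2_i_L01_holds,
    N_FrdII_Thm1_2_i_L02_holds,
    N_FrdII_Thm1_2_i_L03_holds,
    N_FrdII_Thm1_2_i_L04_holds,
    N_FrdII_Thm1_2_i_L05_holds,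
    N_FrdII_Thm1_2_i_L06_holds,
    N_FrdII_Thm1_2_i_L07_holds,
    N_FrdII_Thm1_2_i_L08_holds,
    N_FrdII_Thm1_2_ii_holds,
    N_FrdII_Thm1_2_iii_holds,
    N_FrdII_Thm1_2_iv_holds,
    N_FrdII_Thm1_2_v_holds,
    N_FrdII_Thm1_2_v_L01_holds,
    N_FrdI_Cor4_11_i_L01_holds,
    N_FrdI_Cor4_11_i_L04_holds,
    N_FrdI_Cor4_11_i_L05_holds,
    N_FrdI_Cor4_11_i_L06_holds,
    N_FrdI_Cor4_11_i_L07_holds,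
    N_FrdI_Cor4_11_ii_L08_holds,
    N_FrdI_Cor4_11_ii_L14_holds,
    N_FrdI_Cor4_11_ii_L15_holds,
    N_FrdI_Cor4_11_ii_L17_holds,
    N_FrdI_Cor4_11_iii_L19_holds,
    N_FrdI_Cor4_11_iii_L20_holds,
    N_FrdI_Thm4_2_i_T42_L02_holds,
    N_FrdI_Thm4_2_i_T42_L04_holds,
    N_FrdI_Thm4_2_ii_T42_L08_holds,
    N_FrdI_Thm4_2_iii_T42_L12_holds,
    N_FrdI_Thm4_2_iii_T42_L13_holds,
    N_FrdI_Thm6_4_i_L11_holds,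
    N_FrdII_Thm2_4_i_L04_holds,
    N_FrdII_Thm2_4_i_L05_holds,
    N_FrdII_Thm2_4_i_L07_holds,
    N_FrdII_Thm2_4_i_L08_holds,
    N_FrdII_Thm2_4_i_L09_holds,
    N_FrdII_Thm2_4_i_L11_holds,
    N_FrdII_Thm2_4_i_L12_holds,
    N_FrdII_Thm2_4_ii_L24_holds⟩

/-- **L1 residual, part B**: the index Props of the cone nodes NODES does not (yet) mark discharged — the C-scoreboard entries of this slice
(no theorem is offered for this conjunction, K2b). [claim: Mochizuki2012, status: disputed] -/
def Layer1ResidualB : Prop :=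
  N_FrdII_Def2_1_i -- FrdII:Def2.1(i) · NODES=ACCEPTED · DAGL1f · `_holds`
  ∧ N_FrdII_Def2_1_ii -- FrdII:Def2.1(ii) · NODES=ACCEPTED · DAGL1c · `_holds`
  ∧ N_FrdII_Def2_2_i -- FrdII:Def2.2(i) · NODES=ACCEPTED · DAGL1u · `_holds`
  ∧ N_FrdII_Def2_2_ii -- FrdII:Def2.2(ii) · NODES=ACCEPTED · DAGL1u · `_holds`
  ∧ N_FrdII_Def3_1_i -- FrdII:Def3.1(i) · NODES=ACCEPTED · DAGL1c · `_holds`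
  ∧ N_FrdII_Def3_1_ii.{u₁} -- FrdII:Def3.1(ii) · NODES=ACCEPTED · DAGL1c · `_holds`
  ∧ N_FrdII_Def3_1_iii.{u₁} -- FrdII:Def3.1(iii) · NODES=ACCEPTED · DAGL1c · `_holds`
  ∧ N_FrdII_Def3_1_iv -- FrdII:Def3.1(iv) · NODES=ACCEPTED · DAGL1u · `_holds`
  ∧ N_FrdII_Def3_1_v.{u₁, u₂} -- FrdII:Def3.1(v) · NODES=ACCEPTED · DAGL1u · `_holds`

/-- The [FrdI] §4–§6 + [FrdII] slice of the L1 cone: discharged ∧ residual. [claim: Mochizuki2012, status: disputed] -/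
def Layer1ConeB : Prop :=
  Layer1DischargedB.{u₁, u₂, u₃, u₄, u₅, u₆, u₇, u₈, u₉, u₁₀, u₁₁, u₁₂, u₁₃, u₁₄, u₁₅, u₁₆} ∧ Layer1ResidualB.{u₁, u₂}

/-- The slice follows from its residual alone (the discharged half is witnessed BY NAME). [claim: Mochizuki2012, status: disputed] -/
theorem layer1ConeB_of (h : Layer1ResidualB.{u₁, u₂}) : Layer1ConeB.{u₁, u₂, u₃, u₄, u₅, u₆, u₇, u₈, u₉, u₁₀, u₁₁, u₁₂, u₁₃, u₁₄, u₁₅, u₁₆} :=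
  ⟨layer1DischargedB_holds.{u₁, u₂, u₃, u₄, u₅, u₆, u₇, u₈, u₉, u₁₀, u₁₁, u₁₂, u₁₃, u₁₄, u₁₅, u₁₆}, h⟩

/-! ### d_data rows and the refuted-as-typed row — NAME-CHECKED ONLY (no Prop is asserted) -/
example := @N_FrdI_Cor4_11_i -- FrdI:Cor4.11(i) [data-form, listed]
example := @N_FrdI_Cor4_11_ii -- FrdI:Cor4.11(ii) [data-form, listed]
example := @N_FrdI_Cor4_11_iii -- FrdI:Cor4.11(iii) [data-form, listed]
example := @N_FrdI_Cor4_11_iv -- FrdI:Cor4.11(iv) [data-form, listed]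
example := @N_FrdI_Cor5_4 -- FrdI:Cor5.4 [data-form, listed]
example := @N_FrdI_Prop5_5_i -- FrdI:Prop5.5(i) [data-form, listed]
example := @N_FrdI_Prop5_5_ii -- FrdI:Prop5.5(ii) [data-form, listed]
example := @N_FrdI_Prop5_5_iii -- FrdI:Prop5.5(iii) [data-form, listed]
example := @N_FrdI_Prop5_5_iv -- FrdI:Prop5.5(iv) [data-form, listed]
example := @N_FrdI_Prop5_6 -- FrdI:Prop5.6 [data-form, listed]
example := @N_FrdI_Thm4_2_i -- FrdI:Thm4.2(i) [data-form, listed]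
example := @N_FrdI_Thm4_2_ii -- FrdI:Thm4.2(ii) [data-form, listed]
example := @N_FrdI_Thm4_2_iii -- FrdI:Thm4.2(iii) [data-form, listed]
example := @N_FrdI_Thm4_9 -- FrdI:Thm4.9 [data-form, listed]
example := @N_FrdI_Thm5_1_ii -- FrdI:Thm5.1(ii) [data-form, listed]
example := @N_FrdI_Thm5_1_iv -- FrdI:Thm5.1(iv) [data-form, listed]
example := @N_FrdI_Thm5_2_iii -- FrdI:Thm5.2(iii) [data-form, listed]
example := @N_FrdI_Thm6_2_iv -- FrdI:Thm6.2(iv) [data-form, listed]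
example := @N_FrdI_Thm6_4_i -- FrdI:Thm6.4(i) [data-form, listed]
example := @N_FrdI_Thm6_4_ii -- FrdI:Thm6.4(ii) [data-form, listed]
example := @N_FrdI_Thm6_4_iii -- FrdI:Thm6.4(iii) [data-form, listed]
example := @N_FrdII_Def2_2_iii -- FrdII:Def2.2(iii) [data-form, listed]
example := @N_FrdII_Ex1_1_ii -- FrdII:Ex1.1(ii) [data-form, listed]
example := @N_FrdII_Ex1_3_iii -- FrdII:Ex1.3(iii) [data-form, listed]
example := @N_FrdII_Lem3_2_vii -- FrdII:Lem3.2(vii) [data-form, listed]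
example := @N_FrdII_Thm2_4_i -- FrdII:Thm2.4(i) [data-form, listed]
example := @N_FrdII_Thm2_4_ii -- FrdII:Thm2.4(ii) [data-form, listed]
example := @N_FrdII_Thm3_6_i -- FrdII:Thm3.6(i) [data-form, listed]
example := @N_FrdII_Thm3_6_ii -- FrdII:Thm3.6(ii) [data-form, listed]
example := @N_FrdII_Thm3_6_iii -- FrdII:Thm3.6(iii) [data-form, listed]
example := @N_FrdII_Thm3_6_iv -- FrdII:Thm3.6(iv) [data-form, listed]
example := @N_FrdII_Thm3_6_ix -- FrdII:Thm3.6(ix) [data-form, listed]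
example := @N_FrdII_Thm3_6_v -- FrdII:Thm3.6(v) [data-form, listed]
example := @N_FrdII_Thm3_6_vi -- FrdII:Thm3.6(vi) [data-form, listed]
example := @N_FrdII_Thm3_6_vii -- FrdII:Thm3.6(vii) [data-form, listed]
example := @N_FrdII_Thm3_6_viii -- FrdII:Thm3.6(viii) [data-form, listed]
example := @N_FrdII_Thm3_6_x -- FrdII:Thm3.6(x) [data-form, listed]
example := @N_FrdI_Prop4_4_iii.{u₁, u₂, u₃, u₄, u₅} -- FrdI:Prop4.4(iii) [REFUTED-as-typed (p411683), repaired form proved (p412124); listed, not conjoined]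

end

end Summit.ABC.IUTFork.Conditional
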